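/-
Copyright: statement-level skeleton of a published paper (lit-balaban cell, Phase-2 proof seat p13, gen 12). No proof
claims beyond what the kernel checks below.
-/
import Literature.MathematicalPhysics.QuantumFieldTheory.BalabanImbrieJaffe1984to88.BIJ88CumulantAllOrders5133

/-!
# `BalabanImbrieJaffe1984to88.BIJ88WalkFormOrderOne5133` — T. Bałaban, J. Imbrie, A. Jaffe, *Effective action and cluster
properties of the abelian Higgs model*, Commun. Math. Phys. **114** (1988) 257–315 [BalabanImbrieJaffe1988], §5.13
p. 305–306 [PDF 49–50]: **the random-walk ("train") form of the FIRST `s`-derivative after integration by parts** —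
order one of the walk form of (5.13.3) (*"Thus we have only trains beginning with a δ/δΦ and ending in either δ/δΦ or ℱ"*;
in (5.13.3): `⟨δ/δΦ, C_s□_{i₁}Δ□_{i₂}C_s(½δ/δΦ + ℱ)⟩`).

By `BIJ88CumulantAllOrders5133.dexp_singleton`, `∂{i}⟨H⟩(s) = −⟨[D_i;]H⟩_s` with the pulled-down vertex
`D_i(s,Φ) = Σ_{l≠i}s_l⟨□_iΦ,Δ□_lΦ⟩` (tree sign `Δ = −Δ_print`), a quadratic form in the fields:
`⟨□_iΦ,Δ□_lΦ⟩ = Σ_{x,y} M^{il}_{xy} Φ(x)Φ(y)`, `M^{il}_{xy} = [□(x)=i]Δ_{xy}[□(y)=l]` (`pairMat`, `blockPair_eq_sum`).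
Integrating the two fields of each coordinate pair by parts against `H ∈ C²_b` (p13 g6
`BIJ88TruncatedPair306.pair_truncated_expectation`: the closed loop and the ℱ–ℱ train disappear with the truncation)
and summing over the pairs (`num_Dfun_mul_eq_sum`: linearity, each `Φ(x)Φ(y)H` integrable) gives THE ORDER-ONE WALK
FORM (`dexp_singleton_walk`), with `C = C_s = (Δ_s)⁻¹` (tree: `(interpForm s)⁻¹`), `Z`-normalized `⟨·⟩_s`, `e_x` the
coordinate vectors:

  `∂{i}⟨H⟩(s) = −Σ_{l≠i} s_l Σ_{x,y} M^{il}_{xy} [ ⟨Ce_y,ℱ⟩⟨∂_{Ce_x}H⟩_s + ⟨Ce_x,ℱ⟩⟨∂_{Ce_y}H⟩_s + ⟨∂_{Ce_y}∂_{Ce_x}H⟩_s ]`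

— for each oriented pair `x → y` of sites of the cubes `□_i`, `□_l` a train `δ/δΦ — C — (x,y) — C — ℱ` (two orientations)
or `δ/δΦ — C — (x,y) — C — δ/δΦ`: the `|Γ| = 1` instance of the print's `⟨δ/δΦ, C_s□_{i₁}Δ□_{i₂}C_s(½δ/δΦ + ℱ)⟩`
summed over both orientations (*"The 1/2 for the δ²/δΦ² term compensates for the fact that we count a walk as being
different from its reverse"*), here with the `s_l`-weights of the corrected vertex `D_i` (the print's walks at order one
come from pairings only and are absent, G-C2-24; the corrected first-order term is p13 g6 `BIJ88FirstTerm5133`).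

statement-level skeleton of published theorems with citation tags; proofs where landed; nothing here is a claim
about the Yang–Mills mass gap

PDF held: `paper:balaban1988-cmp114-bij-abelian-higgs-effective-action` (journal page = PDF page + 256).

CITATION HEADER (lean-in-tree rule).  lit-balaban cell (HOME `run/shared/lean/pub/lit-balaban/`), Phase 2, seat p13
gen 12; row **C2.Eq5.13.3-5.13.4** of `HOME/lit-balaban-r16/ROWS-C2-part2.md` (owner r16, referee ref-5; second clause
of the owner's flip condition 2026-08-22T05:08Z/06:23Z, *"the corrected post-IBP walk form of (5.13.3)"* — this file:
order one only; the every-order walk form (joint truncations of two-leg vertices = sums over chains) is NOT here).  USED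
BY NAME, nothing restated: p13 g12 `BIJ88CumulantAllOrders5133.{dexp, dexp_singleton}`, `BIJ88SecondOrder5133.{num, Dfun}`;
p13 g6 `BIJ88TruncatedPair306.pair_truncated_expectation`, `BIJ88IntegrationByParts305.{weight_mul_source,
integrable_fieldProd_bdd_tilt}`; p02 `BIJ88DirichletForms305.{boxProj_mulVec_apply, interpForm_posDef}`,
`BIJ88DirichletDeriv305.blockPair`.

## What is proved (0 `sorry`, standard axioms, no new `Prop` facts)

* `pairMat` (`M^{il}`), **`blockPair_eq_sum`** (`⟨□_iΦ,Δ□_lΦ⟩ = Σ_{x,y}M^{il}_{xy}Φ(x)Φ(y)`), `integrable_pair_mul`,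
  **`num_Dfun_mul_eq_sum`** (`N(D_iG) = Σ_{l≠i}s_lΣ_{x,y}M^{il}_{xy}N(Φ(x)Φ(y)G)` for bounded measurable `G`);
* **`dexp_singleton_walk`** — the order-one walk form above (`s ∈ [0,1]^I`, `H ∈ C²` with `H, DH, D²H` bounded);
* v1.1: `num_blockPair_mul_eq_sum`, **`pmoment_some_walk`** (the vacuum companion: `Mᵀ_s{i} = −⟨D_i⟩_s` as closed loops +
  ℱ–ℱ trains — exactly what truncation removes), **`dexp_pair_walk_pairing`** (order two: the pairing vertex as trains,
  the omitted third truncation `κ₃(D_i,D_l,H)` kept in moment form).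
HONEST SCOPE.  Order one in `|Γ|`; finite dimension; real fields.  NOT summit progress; NOT continuum; NOT Clay.
Imports `BIJ88CumulantAllOrders5133`; modifies nothing.
-/

noncomputable section

namespace Literature.MathematicalPhysics.QuantumFieldTheory.BalabanImbrieJaffe1984to88.BIJ88WalkFormOrderOne5133

open MeasureTheory Matrix Finset Function Filter
open scoped BigOperators Topology
open Literature.MathematicalPhysics.QuantumFieldTheory.Balaban1983to89
open B2Eq228Conditioning (weight source)
open BIJ88DirichletForms305 (interpForm interpForm_posDef boxProj boxProj_mulVec_apply)
open BIJ88DirichletDeriv305 (blockPair)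
open BIJ88IntegrationByParts305 (weight_mul_source integrable_fieldProd_bdd_tilt)
open BIJ88TruncatedPair306 (pair_truncated_expectation pair_vacuum)
open BIJ88SDerivative305 (integral_weight_mul_source_pos)
open BIJ88SecondOrder5133 (num Dfun)
open BIJ88CumulantAllOrders5133 (dexp dexp_singleton dexp_pair pmoment pmoment_some)

section WalkForm

variable {α I : Type} [Fintype α] [DecidableEq α] [Fintype I] [DecidableEq I] (blk : α → I)

/-- The matrix of the vertex `⟨□_iΦ,Δ□_lΦ⟩`: `M^{il}_{xy} = [□(x)=i] Δ_{xy} [□(y)=l]` (`= (□_iΔ□_l)_{xy}`).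
[cite: BalabanImbrieJaffe1988, §5.13 p.305] -/
def pairMat (Δ : Matrix α α ℝ) (i l : I) : Matrix α α ℝ :=
  fun x y => (if blk x = i then 1 else 0) * Δ x y * (if blk y = l then 1 else 0)

omit [Fintype I] in
/-- **The vertex as a sum over coordinate pairs**: `⟨□_iΦ,Δ□_lΦ⟩ = Σ_{x,y} M^{il}_{xy} Φ(x)Φ(y)`, the fields written as
`⟨Φ,e_x⟩`. [cite: BalabanImbrieJaffe1988, §5.13 p.305] -/
theorem blockPair_eq_sum (Δ : Matrix α α ℝ) (φ : α → ℝ) (i l : I) :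
    blockPair blk Δ φ i l
      = ∑ x, ∑ y, pairMat blk Δ i l x y * ((φ ⬝ᵥ Pi.single x 1) * (φ ⬝ᵥ Pi.single y 1)) := by
  simp only [blockPair, dotProduct_single_one, pairMat]
  unfold dotProduct
  refine Finset.sum_congr rfl fun x _ => ?_
  rw [boxProj_mulVec_apply, mulVec, dotProduct, Finset.mul_sum]
  refine Finset.sum_congr rfl fun y _ => ?_
  rw [boxProj_mulVec_apply]
  split_ifs <;> ring

variable {Δ : Matrix α α ℝ} (hΔ : Δ.PosDef) {s : I → ℝ} (hs : ∀ l, 0 ≤ s l ∧ s l ≤ 1) (f : α → ℝ)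
  {G : (α → ℝ) → ℝ} (hGm : AEStronglyMeasurable G volume) {K₀ : ℝ} (hK : ∀ φ, ‖G φ‖ ≤ K₀)

include hΔ hs hGm hK in
/-- `Φ(x)Φ(y)G` is integrable against the interpolated Gaussian (two fields, bounded `G`). [cite: BalabanImbrieJaffe1988, §5.13 p.305] -/
theorem integrable_pair_mul (x y : α) :
    Integrable fun φ : α → ℝ =>
      (φ ⬝ᵥ Pi.single x 1) * (φ ⬝ᵥ Pi.single y 1) * G φ * (weight (interpForm blk Δ s) φ * source f φ) := by
  have h := integrable_fieldProd_bdd_tilt (interpForm_posDef blk hΔ hs) (Finset.univ : Finset (Fin 2))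
    (![Pi.single x 1, Pi.single y 1]) f hGm hK
  refine h.congr (Eventually.of_forall fun φ => ?_)
  simp only [Fin.prod_univ_two, Matrix.cons_val_zero, Matrix.cons_val_one, weight_mul_source]

include hΔ hs hGm hK in
/-- **Linearity**: `N(D_i·G)(s) = Σ_{l≠i} s_l Σ_{x,y} M^{il}_{xy} N(Φ(x)Φ(y)·G)(s)` for bounded measurable `G`.
[cite: BalabanImbrieJaffe1988, §5.13 p.305] -/
theorem num_Dfun_mul_eq_sum (i : I) :
    num blk Δ f (fun φ => Dfun blk Δ s i φ * G φ) s
      = ∑ l ∈ univ.erase i, s l * ∑ x, ∑ y, pairMat blk Δ i l x y *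
          num blk Δ f (fun φ => (φ ⬝ᵥ Pi.single x 1) * (φ ⬝ᵥ Pi.single y 1) * G φ) s := by
  have hI := integrable_pair_mul blk hΔ hs f hGm hK
  -- pointwise expansion of the integrand
  have hpt : ∀ φ : α → ℝ, Dfun blk Δ s i φ * G φ * (weight (interpForm blk Δ s) φ * source f φ)
      = ∑ l ∈ univ.erase i, ∑ x, ∑ y, (s l * pairMat blk Δ i l x y) *
          ((φ ⬝ᵥ Pi.single x 1) * (φ ⬝ᵥ Pi.single y 1) * G φ * (weight (interpForm blk Δ s) φ * source f φ)) := by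
    intro φ
    simp only [Dfun, blockPair_eq_sum, Finset.sum_mul, Finset.mul_sum]
    refine Finset.sum_congr rfl fun l _ => Finset.sum_congr rfl fun x _ => Finset.sum_congr rfl fun y _ => ?_
    ring
  simp only [num]
  rw [integral_congr_ae (Eventually.of_forall hpt)]
  rw [integral_finsetSum _ fun l _ => ?_]
  · refine Finset.sum_congr rfl fun l _ => ?_
    rw [integral_finsetSum _ fun x _ => ?_]
    · rw [Finset.mul_sum]
      refine Finset.sum_congr rfl fun x _ => ?_
      rw [integral_finsetSum _ fun y _ => ?_]
      · rw [Finset.mul_sum]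
        refine Finset.sum_congr rfl fun y _ => ?_
        rw [integral_const_mul]
        ring
      · exact (hI x y).const_mul _
    · exact integrable_finsetSum _ fun y _ => (hI x y).const_mul _
  · exact integrable_finsetSum _ fun x _ => integrable_finsetSum _ fun y _ => (hI x y).const_mul _

include hΔ hs hGm hK in
/-- **Linearity for one vertex**: `N(⟨□_iΦ,Δ□_lΦ⟩·G)(s) = Σ_{x,y} M^{il}_{xy} N(Φ(x)Φ(y)·G)(s)` for bounded measurable `G`
(v1.1). [cite: BalabanImbrieJaffe1988, §5.13 p.305] -/
theorem num_blockPair_mul_eq_sum (i l : I) :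
    num blk Δ f (fun φ => blockPair blk Δ φ i l * G φ) s
      = ∑ x, ∑ y, pairMat blk Δ i l x y *
          num blk Δ f (fun φ => (φ ⬝ᵥ Pi.single x 1) * (φ ⬝ᵥ Pi.single y 1) * G φ) s := by
  have hI := integrable_pair_mul blk hΔ hs f hGm hK
  have hpt : ∀ φ : α → ℝ, blockPair blk Δ φ i l * G φ * (weight (interpForm blk Δ s) φ * source f φ)
      = ∑ x, ∑ y, pairMat blk Δ i l x y *
          ((φ ⬝ᵥ Pi.single x 1) * (φ ⬝ᵥ Pi.single y 1) * G φ * (weight (interpForm blk Δ s) φ * source f φ)) := by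
    intro φ
    simp only [blockPair_eq_sum, Finset.sum_mul]
    refine Finset.sum_congr rfl fun x _ => Finset.sum_congr rfl fun y _ => ?_
    ring
  simp only [num]
  rw [integral_congr_ae (Eventually.of_forall hpt)]
  rw [integral_finsetSum _ fun x _ => ?_]
  · refine Finset.sum_congr rfl fun x _ => ?_
    rw [integral_finsetSum _ fun y _ => ?_]
    · refine Finset.sum_congr rfl fun y _ => ?_
      rw [integral_const_mul]
    · exact (hI x y).const_mul _
  · exact integrable_finsetSum _ fun y _ => (hI x y).const_mul _

end WalkForm

section Main

variable {α I : Type} [Fintype α] [DecidableEq α] [Fintype I] [DecidableEq I] (blk : α → I)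
  {Δ : Matrix α α ℝ} (hΔ : Δ.PosDef) {c C : ℝ} (hc : 0 < c)
  (hcΔ : ∀ v, c * (v ⬝ᵥ v) ≤ v ⬝ᵥ (Δ *ᵥ v)) (hCΔ : ∀ v, v ⬝ᵥ (Δ *ᵥ v) ≤ C * (v ⬝ᵥ v))
  {s : I → ℝ} (hs : ∀ l, 0 ≤ s l ∧ s l ≤ 1) (f : α → ℝ)
  {H : (α → ℝ) → ℝ} (hH : ContDiff ℝ 2 H) {K₀ K₁ K₂ : ℝ} (h0 : ∀ φ, ‖H φ‖ ≤ K₀)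
  (h1 : ∀ φ, ‖fderiv ℝ H φ‖ ≤ K₁) (h2 : ∀ φ, ‖fderiv ℝ (fderiv ℝ H) φ‖ ≤ K₂)

include hΔ hs hH h0 h1 h2 in
/-- **THE ORDER-ONE WALK FORM** (`s ∈ [0,1]^I`, `H ∈ C²` with `H, DH, D²H` bounded; `C = (Δ_s)⁻¹` in tree sign,
`⟨X⟩_s = N_X(s)/N_1(s)`, `e_x` the coordinate vectors):
`∂{i}⟨H⟩(s) = −Σ_{l≠i} s_l Σ_{x,y} M^{il}_{xy} [⟨Ce_y,ℱ⟩⟨∂_{Ce_x}H⟩_s + ⟨Ce_x,ℱ⟩⟨∂_{Ce_y}H⟩_s + ⟨∂_{Ce_y}∂_{Ce_x}H⟩_s]`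
— *"only trains beginning with a δ/δΦ and ending in either δ/δΦ or ℱ"*, the `|Γ| = 1` case of (5.13.3)'s
`⟨δ/δΦ, C_s□_{i₁}Δ□_{i₂}C_s(½δ/δΦ + ℱ)⟩` (both orientations), with the corrected vertex's `s_l`-weights.
[cite: BalabanImbrieJaffe1988, §5.13 (5.13.3) p.305–306] -/
theorem dexp_singleton_walk (i : I) :
    dexp blk Δ f H {i} s
      = -∑ l ∈ univ.erase i, s l * ∑ x, ∑ y, pairMat blk Δ i l x y *
          ( ((interpForm blk Δ s)⁻¹ *ᵥ Pi.single y 1) ⬝ᵥ f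
              * (num blk Δ f (fun φ => fderiv ℝ H φ ((interpForm blk Δ s)⁻¹ *ᵥ Pi.single x 1)) s
                  / num blk Δ f (fun _ => 1) s)
            + ((interpForm blk Δ s)⁻¹ *ᵥ Pi.single x 1) ⬝ᵥ f
              * (num blk Δ f (fun φ => fderiv ℝ H φ ((interpForm blk Δ s)⁻¹ *ᵥ Pi.single y 1)) s
                  / num blk Δ f (fun _ => 1) s)
            + num blk Δ f (fun φ => fderiv ℝ (fun ψ : α → ℝ => fderiv ℝ H ψ ((interpForm blk Δ s)⁻¹ *ᵥ Pi.single x 1))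
                  φ ((interpForm blk Δ s)⁻¹ *ᵥ Pi.single y 1)) s
                  / num blk Δ f (fun _ => 1) s ) := by
  have hA := interpForm_posDef blk hΔ hs
  have hHm : AEStronglyMeasurable H volume := hH.continuous.aestronglyMeasurable
  -- the truncated pair, per coordinate pair, in `num` notation
  have key : ∀ x y : α,
      num blk Δ f (fun φ => (φ ⬝ᵥ Pi.single x 1) * (φ ⬝ᵥ Pi.single y 1) * H φ) s / num blk Δ f (fun _ => 1) s
        - num blk Δ f (fun φ => (φ ⬝ᵥ Pi.single x 1) * (φ ⬝ᵥ Pi.single y 1) * (1:ℝ)) s / num blk Δ f (fun _ => 1) s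
          * (num blk Δ f H s / num blk Δ f (fun _ => 1) s)
      = ((interpForm blk Δ s)⁻¹ *ᵥ Pi.single y 1) ⬝ᵥ f
              * (num blk Δ f (fun φ => fderiv ℝ H φ ((interpForm blk Δ s)⁻¹ *ᵥ Pi.single x 1)) s
                  / num blk Δ f (fun _ => 1) s)
            + ((interpForm blk Δ s)⁻¹ *ᵥ Pi.single x 1) ⬝ᵥ f
              * (num blk Δ f (fun φ => fderiv ℝ H φ ((interpForm blk Δ s)⁻¹ *ᵥ Pi.single y 1)) s
                  / num blk Δ f (fun _ => 1) s)
            + num blk Δ f (fun φ => fderiv ℝ (fun ψ : α → ℝ => fderiv ℝ H ψ ((interpForm blk Δ s)⁻¹ *ᵥ Pi.single x 1))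
                  φ ((interpForm blk Δ s)⁻¹ *ᵥ Pi.single y 1)) s
                  / num blk Δ f (fun _ => 1) s := by
    intro x y
    have h := pair_truncated_expectation (interpForm blk Δ s) hA f hH h0 h1 h2 (Pi.single x 1) (Pi.single y 1)
    simp only [num, one_mul, mul_one]
    exact h
  rw [dexp_singleton, num_Dfun_mul_eq_sum blk hΔ hs f hHm h0 i,
    show num blk Δ f (Dfun blk Δ s i) s = num blk Δ f (fun φ => Dfun blk Δ s i φ * (1:ℝ)) s by simp only [mul_one],
    num_Dfun_mul_eq_sum blk hΔ hs f aestronglyMeasurable_const (K₀ := 1) (fun _ => by simp) i]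
  simp_rw [← key]
  simp only [Finset.sum_div, Finset.sum_mul, Finset.mul_sum, mul_sub, Finset.sum_sub_distrib]
  congr 1
  congr 1
  · refine Finset.sum_congr rfl fun l _ => Finset.sum_congr rfl fun x _ => Finset.sum_congr rfl fun y _ => ?_
    ring
  · refine Finset.sum_congr rfl fun l _ => Finset.sum_congr rfl fun x _ => Finset.sum_congr rfl fun y _ => ?_
    ring

include hΔ hs in
/-- **The vacuum companion at order one** (v1.1; the first derivative of `log N_1`): `Mᵀ_s{some i} = −⟨D_i⟩_s =
−Σ_{l≠i} s_l Σ_{x,y} M^{il}_{xy} [⟨Ce_x, e_y⟩ + ⟨Ce_x,ℱ⟩⟨Ce_y,ℱ⟩]` — exactly the two structures that *"disappear with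
truncation"*: *"a closed loop … or … a train of covariances beginning and ending in ℱ"* (p13 g6 `pair_vacuum` summed over
the site pairs). [cite: BalabanImbrieJaffe1988, §5.13 p.305–306] -/
theorem pmoment_some_walk (H : (α → ℝ) → ℝ) (i : I) :
    pmoment blk Δ f H s {some i}
      = -∑ l ∈ univ.erase i, s l * ∑ x, ∑ y, pairMat blk Δ i l x y *
          ( ((interpForm blk Δ s)⁻¹ *ᵥ Pi.single x 1) ⬝ᵥ Pi.single y 1
            + ((interpForm blk Δ s)⁻¹ *ᵥ Pi.single x 1) ⬝ᵥ f
              * (((interpForm blk Δ s)⁻¹ *ᵥ Pi.single y 1) ⬝ᵥ f) ) := by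
  have hA := interpForm_posDef blk hΔ hs
  have hZ : num blk Δ f (fun _ => (1:ℝ)) s ≠ 0 := by
    have := integral_weight_mul_source_pos hA f
    simp only [num, one_mul]
    exact this.ne'
  have key : ∀ x y : α,
      num blk Δ f (fun φ => (φ ⬝ᵥ Pi.single x 1) * (φ ⬝ᵥ Pi.single y 1) * (1:ℝ)) s
        = (((interpForm blk Δ s)⁻¹ *ᵥ Pi.single x 1) ⬝ᵥ Pi.single y 1
            + ((interpForm blk Δ s)⁻¹ *ᵥ Pi.single x 1) ⬝ᵥ f
              * (((interpForm blk Δ s)⁻¹ *ᵥ Pi.single y 1) ⬝ᵥ f))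
          * num blk Δ f (fun _ => (1:ℝ)) s := by
    intro x y
    have h := pair_vacuum (interpForm blk Δ s) hA f (Pi.single x 1) (Pi.single y 1)
    simp only [num, mul_one, one_mul]
    exact h
  rw [pmoment_some,
    show num blk Δ f (Dfun blk Δ s i) s = num blk Δ f (fun φ => Dfun blk Δ s i φ * (1:ℝ)) s by simp only [mul_one],
    num_Dfun_mul_eq_sum blk hΔ hs f aestronglyMeasurable_const (K₀ := 1) (fun _ => by simp) i]
  simp_rw [key]
  congr 1
  rw [div_eq_iff hZ, Finset.sum_mul]
  refine Finset.sum_congr rfl fun l _ => ?_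
  rw [mul_assoc, Finset.sum_mul]
  congr 1
  refine Finset.sum_congr rfl fun x _ => ?_
  rw [Finset.sum_mul]
  refine Finset.sum_congr rfl fun y _ => ?_
  ring

include hΔ hc hcΔ hCΔ hs hH h0 h1 h2 in
/-- **Order two, the pairing vertex integrated by parts** (v1.1; `i ≠ l`; form bounds `c‖v‖² ≤ ⟨v,Δv⟩ ≤ C‖v‖²` as in
`BIJ88CumulantAllOrders5133.dexp_pair`): in
`∂{i,l}⟨H⟩(s) = −⟨[B_{il};]H⟩_s + κ₃(D_i,D_l,H)_s` (`BIJ88CumulantAllOrders5133.dexp_pair`) the pairing term — the one the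
print keeps — is the train sum `−Σ_{x,y} M^{il}_{xy}[⟨Ce_y,ℱ⟩⟨∂_{Ce_x}H⟩_s + ⟨Ce_x,ℱ⟩⟨∂_{Ce_y}H⟩_s + ⟨∂_{Ce_y}∂_{Ce_x}H⟩_s]`
(print's `⟨δ/δΦ, C_s□_{i}Δ□_{l}C_s(½δ/δΦ + ℱ)⟩`, both orientations), while the third truncation `κ₃(D_i,D_l,H)` — the term
the print omits (G-C2-24) — is kept in moment form (its walk form needs four integrations by parts: the two vertices
either link into one train or hook into `H` separately). [cite: BalabanImbrieJaffe1988, §5.13 (5.13.3) p.305–306] -/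
theorem dexp_pair_walk_pairing {i l : I} (hil : i ≠ l) :
    dexp blk Δ f H {i, l} s
      = -(∑ x, ∑ y, pairMat blk Δ i l x y *
          ( ((interpForm blk Δ s)⁻¹ *ᵥ Pi.single y 1) ⬝ᵥ f
              * (num blk Δ f (fun φ => fderiv ℝ H φ ((interpForm blk Δ s)⁻¹ *ᵥ Pi.single x 1)) s
                  / num blk Δ f (fun _ => 1) s)
            + ((interpForm blk Δ s)⁻¹ *ᵥ Pi.single x 1) ⬝ᵥ f
              * (num blk Δ f (fun φ => fderiv ℝ H φ ((interpForm blk Δ s)⁻¹ *ᵥ Pi.single y 1)) s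
                  / num blk Δ f (fun _ => 1) s)
            + num blk Δ f (fun φ => fderiv ℝ (fun ψ : α → ℝ => fderiv ℝ H ψ ((interpForm blk Δ s)⁻¹ *ᵥ Pi.single x 1))
                  φ ((interpForm blk Δ s)⁻¹ *ᵥ Pi.single y 1)) s
                  / num blk Δ f (fun _ => 1) s ))
        + (num blk Δ f (fun φ => Dfun blk Δ s i φ * Dfun blk Δ s l φ * H φ) s / num blk Δ f (fun _ => 1) s
          - num blk Δ f (Dfun blk Δ s i) s / num blk Δ f (fun _ => 1) s
            * (num blk Δ f (fun φ => Dfun blk Δ s l φ * H φ) s / num blk Δ f (fun _ => 1) s)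
          - num blk Δ f (Dfun blk Δ s l) s / num blk Δ f (fun _ => 1) s
            * (num blk Δ f (fun φ => Dfun blk Δ s i φ * H φ) s / num blk Δ f (fun _ => 1) s)
          - num blk Δ f (fun φ => Dfun blk Δ s i φ * Dfun blk Δ s l φ) s / num blk Δ f (fun _ => 1) s
            * (num blk Δ f H s / num blk Δ f (fun _ => 1) s)
          + 2 * (num blk Δ f (Dfun blk Δ s i) s / num blk Δ f (fun _ => 1) s)
            * (num blk Δ f (Dfun blk Δ s l) s / num blk Δ f (fun _ => 1) s)
            * (num blk Δ f H s / num blk Δ f (fun _ => 1) s)) := by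
  have hA := interpForm_posDef blk hΔ hs
  have hHm : AEStronglyMeasurable H volume := hH.continuous.aestronglyMeasurable
  have key : ∀ x y : α,
      num blk Δ f (fun φ => (φ ⬝ᵥ Pi.single x 1) * (φ ⬝ᵥ Pi.single y 1) * H φ) s / num blk Δ f (fun _ => 1) s
        - num blk Δ f (fun φ => (φ ⬝ᵥ Pi.single x 1) * (φ ⬝ᵥ Pi.single y 1) * (1:ℝ)) s / num blk Δ f (fun _ => 1) s
          * (num blk Δ f H s / num blk Δ f (fun _ => 1) s)
      = ((interpForm blk Δ s)⁻¹ *ᵥ Pi.single y 1) ⬝ᵥ f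
              * (num blk Δ f (fun φ => fderiv ℝ H φ ((interpForm blk Δ s)⁻¹ *ᵥ Pi.single x 1)) s
                  / num blk Δ f (fun _ => 1) s)
            + ((interpForm blk Δ s)⁻¹ *ᵥ Pi.single x 1) ⬝ᵥ f
              * (num blk Δ f (fun φ => fderiv ℝ H φ ((interpForm blk Δ s)⁻¹ *ᵥ Pi.single y 1)) s
                  / num blk Δ f (fun _ => 1) s)
            + num blk Δ f (fun φ => fderiv ℝ (fun ψ : α → ℝ => fderiv ℝ H ψ ((interpForm blk Δ s)⁻¹ *ᵥ Pi.single x 1))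
                  φ ((interpForm blk Δ s)⁻¹ *ᵥ Pi.single y 1)) s
                  / num blk Δ f (fun _ => 1) s := by
    intro x y
    have h := pair_truncated_expectation (interpForm blk Δ s) hA f hH h0 h1 h2 (Pi.single x 1) (Pi.single y 1)
    simp only [num, one_mul, mul_one]
    exact h
  rw [dexp_pair blk hΔ hc hcΔ hCΔ hs f hHm h0 hil, num_blockPair_mul_eq_sum blk hΔ hs f hHm h0 i l,
    show num blk Δ f (fun φ => blockPair blk Δ φ i l) s = num blk Δ f (fun φ => blockPair blk Δ φ i l * (1:ℝ)) s by
      simp only [mul_one],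
    num_blockPair_mul_eq_sum blk hΔ hs f aestronglyMeasurable_const (K₀ := 1) (fun _ => by simp) i l]
  simp_rw [← key]
  simp only [Finset.sum_div, Finset.sum_mul, mul_sub, Finset.sum_sub_distrib]
  congr 1
  congr 1
  congr 1
  · refine Finset.sum_congr rfl fun x _ => Finset.sum_congr rfl fun y _ => ?_
    ring
  · refine Finset.sum_congr rfl fun x _ => Finset.sum_congr rfl fun y _ => ?_
    ring

end Main

end Literature.MathematicalPhysics.QuantumFieldTheory.BalabanImbrieJaffe1984to88.BIJ88WalkFormOrderOne5133
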